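import Mathlib
import Summits.ResolutionOfSingularities.ResolutionOfSingularities.Theorems.HomologicalConductorPersistenceCyclicQuotientSummandData
import Summits.ResolutionOfSingularities.ResolutionOfSingularities.Theorems.HomologicalConductorPersistenceSummandDataBaseChange
import Summits.ResolutionOfSingularities.ResolutionOfSingularities.Theorems.HomologicalConductorPersistenceSurfaceCompleteHerzogTransfer
import Summits.ResolutionOfSingularities.ResolutionOfSingularities.Theorems.HomologicalConductorPersistenceSurfaceLocalHerzogIsLocalization
import Summits.ResolutionOfSingularities.ResolutionOfSingularities.Theorems.HomologicalConductorPersistenceCyclicQuotientVertexDimension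
import Summits.ResolutionOfSingularities.ResolutionOfSingularities.Theorems.HomologicalConductorPersistenceSurfaceSaturationCommonCompletion
import Summits.ResolutionOfSingularities.ResolutionOfSingularities.Theorems.HomologicalConductorPersistenceSurfaceSaturationIsolatedLocalization
import Literature.RingTheory.CohomologyAnnihilator.CompletionTheorem
import Literature.AlgebraicGeometry.Resolution.AdicNoetherian
import Literature.AlgebraicGeometry.Resolution.AdicCompletionRegular
import HarnessLib

/-!
# Rung S-2 `PersistenceSurface` (stmt-ResolutionOfSingularities-19970), stub C1 (`Sat₄`) — LEVELLED `Sat₄` ON THE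
# COMPLETED CYCLIC QUOTIENT and `Sat₄` (not `Sat₆`) AT EVERY ANALYTICALLY-TORIC SURFACE STAGE

[OURS · cell decomp-res · rung S-2; seat leafhand-res-homologicalconduct-17 gen 0]  Nothing here is a statement of the
manuscript under review (Hironaka 2017); AI-written, weaker than expert review.  DEF-FREE.

Items (F2)–(F4) of the repair census of hand 15 (HAND15-TRANSPORT §3): the capstone of the LEVEL-EXACT completion
transport of the toric `Sat₄` theorem.  `U = k[u,v]^{(n;1,q)}` (`gcd(q,n) = 1`, `k` any field) is the degree-`0`
subalgebra of the `(1,q)`-grading in `ZMod n`; `S` is any localisation of `U` (`[IsLocalization P S]`, noetherian local —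
e.g. `U` localised at its vertex `𝔪 ∋ uⁿ, vⁿ`); `S'` is a «completion-like» `S`-algebra: flat, local, `𝔪S' = 𝔪'`, `S` dense,
noetherian, a domain of Krull dimension `2` and an isolated singularity (e.g. `S' = Ŝ` when `Ŝ` is a domain and an isolated
singularity).  Then `caᵐ(S') = ca⁴(S') = ca(S')` for every `m ≥ 4`.  Assembly, all bricks landed: the summand data of the
cyclic-quotient theorem (`…CyclicQuotientSummandData`) base-change along the flat `U → S'`
(`…SummandDataBaseChange.cohomologyAnnihilatorOfDegree_eq_of_summandData_baseChange`), and the `add (S' ⊗_U k[u,v])`-cover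
of the second syzygies over `S'` is «graded Herzog ⇒ local Herzog (`…LocalHerzogIsLocalization`, any localisation) ⇒
complete Herzog (`…CompleteHerzogTransfer`)» with the generator rewritten along `S' ⊗_S (S ⊗_U V) ≅ S' ⊗_U V`.

Through the landed level-exact door `…CommonCompletion.cohomologyAnnihilator_le_caAt_of_levelled_of_ringEquiv_completion`
this gives **`ca(T) = ca⁴(T)` at every noetherian local surface stage `T` whose completion is ring-isomorphic to the
completion of `U` localised at the vertex** (`T̂` a domain and an isolated singularity, `Ŝ` an isolated singularity) — the
stub's `Sat₄` on the analytically-toric class, improving the landed `Sat₆` (`…VertexDimension`, BHST shift) by exactly the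
dimension.  What remains of stub C1's toric class after this file is RECOGNITION (which residual stages have toric
completion) and the discharge of «`Ŝ` is an isolated singularity / `T̂` is a domain» for the stages of the tower (for local
rings essentially of finite type over `k` the first is `…CompletionIsolatedTransfer`).

* `exists_summandData_cyclicQuotient` — the summand data from `gcd(q,n) = 1` alone (Hirzebruch–Jung chain of `n/(q mod n)`);
* `levelledSatFour_of_completionLike` — (F2) `caᵐ(S') = ca⁴(S') = ca(S')`, `m ≥ 4`, for completion-like `S'` over any
  noetherian local localisation `S` of `U`;
* `levelledSatFour_adicCompletion` — (F3) the case `S' = Ŝ` (`dim S = 2`, `Ŝ` a domain and an isolated singularity);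
* `levelledSatFour_adicCompletion_atVertex` — at the vertex (`dim S = 2` computed by `…VertexDimension`);
* `cohomologyAnnihilator_le_caAt_four_of_ringEquiv_completion_vertex`,
  `cohomologyAnnihilator_eq_caAt_four_of_ringEquiv_completion_vertex` — (F4) **`Sat₄` at every analytically-toric
  surface stage**.

References: S. B. Iyengar, R. Takahashi, IMRN 2016, Def. 2.1/4.1, Lemma 2.10, Thm. 5.4 [`IyengarTakahashi2014`];
A. Bahlekeh, E. Hakimian, S. Salarian, R. Takahashi, Q. J. Math. 67 (2016), Thm. 4.5 / Cor. 4.4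
[`BahlekehHakimianSalarianTakahashi2015`]; J. Wunram, Math. Ann. 279 (1988); J. Herzog, Math. Ann. 233 (1978) — through
landed tree lemmas only.
-/

-- single-problem summit: the doubled namespace component `ResolutionOfSingularities` is forced
set_option linter.dupNamespace false

noncomputable section

open CategoryTheory IsLocalRing TensorProduct MvPolynomial Literature.RingTheory.CohomologyAnnihilator
open Literature.RingTheory.CohomologyAnnihilator.BHST2015.CompletionAscentHolds (dense_adicCompletion)
open Literature.AlgebraicGeometry.Resolution (isNoetherianRing_adicCompletion_maximalIdeal ringKrullDim_adicCompletion)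
open Summit.ResolutionOfSingularities.ResolutionOfSingularities.Theorems.HomologicalConductor.PersistenceCyclicQuotientCharFree
  (isNoetherianRing_degreeZero)
open Summit.ResolutionOfSingularities.ResolutionOfSingularities.Theorems.HomologicalConductor.PersistenceCyclicQuotientNumeration
  (exists_chain)
open Summit.ResolutionOfSingularities.ResolutionOfSingularities.Theorems.HomologicalConductor.PersistenceCyclicQuotientSummandData
  (exists_summandData_cyclicQuotient_of_chain_charFree)
open Summit.ResolutionOfSingularities.ResolutionOfSingularities.Theorems.HomologicalConductor.PersistenceSummandDataBaseChange
  (cohomologyAnnihilatorOfDegree_eq_of_summandData_baseChange)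
open Summit.ResolutionOfSingularities.ResolutionOfSingularities.Theorems.HomologicalConductor.PersistenceSurfaceCompleteHerzogTransfer
  (isRetractOfPower_of_isSyzygy_two_of_completionLike)
open Summit.ResolutionOfSingularities.ResolutionOfSingularities.Theorems.HomologicalConductor.PersistenceSurfaceLocalHerzogIsLocalization
  (isRetractOfPower_of_isSyzygy_two_of_isLocalization)
open Summit.ResolutionOfSingularities.ResolutionOfSingularities.Theorems.HomologicalConductor.PersistenceCyclicQuotientVertexIsolated
  (X_pow_mem)
open Summit.ResolutionOfSingularities.ResolutionOfSingularities.Theorems.HomologicalConductor.PersistenceCyclicQuotientVertexDimension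
  (ringKrullDim_atVertex)
open Summit.ResolutionOfSingularities.ResolutionOfSingularities.Theorems.HomologicalConductor.PersistenceSurfaceSaturationCommonCompletion
  (cohomologyAnnihilator_le_caAt_of_levelled_of_ringEquiv_completion)

universe u

namespace Summit.ResolutionOfSingularities.ResolutionOfSingularities.Theorems.HomologicalConductor.PersistenceCyclicQuotientCompletionSatFour

variable {k : Type u} [Field k] {n : ℕ} [NeZero n] {q : ℕ} (U : Subalgebra k (MvPolynomial (Fin 2) k))
variable (hU : ∀ p, p ∈ U ↔ weightedHomogeneousComponent (![1, (q : ZMod n)] : Fin 2 → ZMod n) 0 p = p)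

/-! ## The summand data from `gcd(q,n) = 1` -/

include hU in
/-- **The summand data of the cyclic-quotient `Sat₄` theorem, from coprimality alone.**  For `gcd(q,n) = 1` (any
residue `q`, `n = 1` included): weight pieces `M'_a` splitting `k[u,v]|_U`, first syzygies `K_a`, a cospecial test
family `ψ` with finitely generated pieces, Wunram's law, Ω-stability, and Herzog's cover of the second syzygies — the
output of `exists_summandData_cyclicQuotient_of_chain_charFree` on the Hirzebruch–Jung chain of `n/(q mod n)` (the weights
only see `q mod n`; `n ∣ q` forces `n = 1`, the empty chain). [OURS · cell decomp-res] -/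
theorem exists_summandData_cyclicQuotient (hq : q.Coprime n) :
    ∃ (e : ℕ) (M' K : ZMod n → ModuleCat.{u} U)
      (_ : (restrictScalarsFunctor U (MvPolynomial (Fin 2) k)).obj
        (ModuleCat.of (MvPolynomial (Fin 2) k) (MvPolynomial (Fin 2) k)) ≅ ModuleCat.of U (Π a, M' a))
      (ψ : Fin e → ZMod n) (_ : ∀ t, Module.Finite U (M' (ψ t))),
      (∀ a, IsSyzygy 1 (M' a) (K a)) ∧
      (∀ a, IsRetractOfPower (ModuleCat.of U ((Π t, M' (ψ t)) × U)) (K a)) ∧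
      (∀ t, ∃ (s : Fin e) (ι : M' (ψ t) ⟶ K (ψ s)) (r : K (ψ s) ⟶ M' (ψ t)), ι ≫ r = 𝟙 (M' (ψ t))) ∧
      (∀ (N L : ModuleCat.{u} U), Module.Finite U N → IsSyzygy 2 N L →
        IsRetractOfPower ((restrictScalarsFunctor U (MvPolynomial (Fin 2) k)).obj
          (ModuleCat.of (MvPolynomial (Fin 2) k) (MvPolynomial (Fin 2) k))) L) := by
  classical
  have hnpos : 0 < n := Nat.pos_of_ne_zero (NeZero.ne n)
  -- the weights only see `q mod n`
  have hU' : ∀ p, p ∈ U ↔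
      weightedHomogeneousComponent (![1, ((q % n : ℕ) : ZMod n)] : Fin 2 → ZMod n) 0 p = p := by
    intro p; rw [ZMod.natCast_mod]; exact hU p
  have hq'n : (q % n).Coprime n := by
    rw [Nat.coprime_iff_gcd_eq_one, ← Nat.gcd_rec, Nat.gcd_comm]
    exact hq
  rcases Nat.eq_zero_or_pos (q % n) with hq0 | hq0
  · -- `n ∣ q`: `n = 1`, the empty chain `i = (1, 0, …)`
    have hn1 : n = 1 := by
      have h : Nat.gcd (q % n) n = 1 := hq'n
      rwa [hq0, Nat.gcd_zero_left] at h
    obtain ⟨-, -, M', K, eM, ψ, hfin, -, -, hK, hKD, hD, hcov⟩ :=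
      exists_summandData_cyclicQuotient_of_chain_charFree U hU' (e := 0) (i := fun s => if s = 0 then 1 else 0)
        (b := fun _ => 0) (by rw [if_pos rfl, hn1]) (by rw [if_neg one_ne_zero, hq0]) (by rw [if_pos rfl])
        (by rw [if_neg (by omega)]) (fun s hs1 hs0 => by omega) (fun s hs1 hs0 => by omega)
    exact ⟨0, M', K, eM, ψ, hfin, hK, hKD, hD, hcov⟩
  · obtain ⟨e, i, b, -, hi0, hi1, hie, hie1, hrec, hb⟩ := exists_chain n (q % n) hq0 (Nat.mod_lt _ hnpos) hq'n.symm
    obtain ⟨-, -, M', K, eM, ψ, hfin, -, -, hK, hKD, hD, hcov⟩ :=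
      exists_summandData_cyclicQuotient_of_chain_charFree U hU' hi0 hi1 hie hie1 hrec hb
    exact ⟨e, M', K, eM, ψ, hfin, hK, hKD, hD, hcov⟩

/-! ## (F2) Levelled `Sat₄` on a completion-like extension of a localisation of `U` -/

include hU in
/-- **(F2) LEVELLED `Sat₄` ON A COMPLETION-LIKE EXTENSION.**  `U = k[u,v]^{(n;1,q)}` with `gcd(q,n) = 1`, `S` a
noetherian local localisation of `U` at a multiplicative set `P`, `S'` an `S`-algebra (with the induced `U`-structure)
which is flat, local with `𝔪S' = 𝔪'` and `S` dense, noetherian, a domain of Krull dimension `2` and an isolated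
singularity.  Then `caᵐ(S') = ca⁴(S')` for every `m ≥ 4` and `ca(S') = ca⁴(S')`.  Proof: summand data of the toric
theorem base-changed along the flat `U → S'`; second syzygies over `S'` covered by `add (S' ⊗_U k[u,v])` via
«graded ⇒ local ⇒ complete Herzog». [OURS · cell decomp-res] -/
theorem levelledSatFour_of_completionLike (hq : q.Coprime n) (P : Submonoid U)
    (S : Type u) [CommRing S] [Algebra U S] [IsLocalization P S] [IsNoetherianRing S] [IsLocalRing S]
    (S' : Type u) [CommRing S'] [Algebra S S'] [Algebra U S'] [IsScalarTower U S S'] [IsNoetherianRing S']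
    [IsLocalRing S'] [Module.Flat S S'] [IsDomain S']
    (hmap : (maximalIdeal S).map (algebraMap S S') = maximalIdeal S')
    (hdense : ∀ (j : ℕ) (s : S'), ∃ r : S, s - algebraMap S S' r ∈ maximalIdeal S' ^ j)
    (hdim : ringKrullDim S' = (2 : ℕ)) (hiso : IsIsolatedSingularity S') :
    (∀ m : ℕ, 4 ≤ m → cohomologyAnnihilatorOfDegree S' m = cohomologyAnnihilatorOfDegree S' 4) ∧
      cohomologyAnnihilator S' = cohomologyAnnihilatorOfDegree S' 4 := by
  classical
  haveI : IsNoetherianRing U := isNoetherianRing_degreeZero (k := k) (n := n) q U hU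
  obtain ⟨e, M', K, eM, ψ, hfin, hK, hKD, hD, hcov⟩ := exists_summandData_cyclicQuotient U hU hq
  haveI := hfin
  -- `U → S → S'` is flat
  haveI : Module.Flat U S := IsLocalization.flat S P
  haveI : Module.Flat U S' := Module.Flat.trans U S S'
  -- local Herzog over `S`
  have hHerzogS : ∀ (M L : ModuleCat.{u} S), Module.Finite S M → IsSyzygy 2 M L →
      IsRetractOfPower (ModuleCat.of S (S ⊗[U] ((restrictScalarsFunctor U (MvPolynomial (Fin 2) k)).obj
        (ModuleCat.of (MvPolynomial (Fin 2) k) (MvPolynomial (Fin 2) k))))) L := by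
    intro M L hM hL
    haveI := hM
    exact isRetractOfPower_of_isSyzygy_two_of_isLocalization P S _ hcov M L hL
  -- complete Herzog over `S'`, generator rewritten along `S' ⊗_S (S ⊗_U V) ≅ S' ⊗_U V`
  have hcov' : ∀ (N L : ModuleCat.{u} S'), Module.Finite S' N → IsSyzygy 2 N L →
      IsRetractOfPower (ModuleCat.of S' (S' ⊗[U] ((restrictScalarsFunctor U (MvPolynomial (Fin 2) k)).obj
        (ModuleCat.of (MvPolynomial (Fin 2) k) (MvPolynomial (Fin 2) k))))) L := by
    intro N L hN hL
    haveI := hN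
    have h := isRetractOfPower_of_isSyzygy_two_of_completionLike S' hmap hdense hdim hiso _ hHerzogS N L hL
    let eG := AlgebraTensorModule.cancelBaseChange U S S' S'
      ((restrictScalarsFunctor U (MvPolynomial (Fin 2) k)).obj
        (ModuleCat.of (MvPolynomial (Fin 2) k) (MvPolynomial (Fin 2) k)))
    exact ((isRetractOfPower_self _).of_iso eG.symm.toModuleIso).of_isRetractOfPower_gen h
  obtain ⟨hlev, hca⟩ := cohomologyAnnihilatorOfDegree_eq_of_summandData_baseChange S' 2 hcov' M' K eM hK ψ hKD hD
  exact ⟨fun m hm => hlev m hm, hca⟩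

/-! ## (F3) The completion of a two-dimensional localisation of `U` -/

include hU in
/-- **(F3) LEVELLED `Sat₄` ON `Ŝ`.**  `U = k[u,v]^{(n;1,q)}` with `gcd(q,n) = 1`, `S` a noetherian local localisation of
`U` of Krull dimension `2` whose `𝔪`-adic completion `Ŝ` is a domain and an isolated singularity ⇒ `caᵐ(Ŝ) = ca⁴(Ŝ)`
(`m ≥ 4`) and `ca(Ŝ) = ca⁴(Ŝ)`.  The completion-like hypotheses of (F2) are the tree's: `Ŝ` flat (Mathlib), `𝔪Ŝ = 𝔪̂`
(`AdicCompletion.maximalIdeal_eq_map`), `S` dense (`dense_adicCompletion`), `Ŝ` noetherian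
(`isNoetherianRing_adicCompletion_maximalIdeal`), `dim Ŝ = dim S` (`ringKrullDim_adicCompletion`).
[cite: BahlekehHakimianSalarianTakahashi2015, Thm. 4.5] -/
theorem levelledSatFour_adicCompletion (hq : q.Coprime n) (P : Submonoid U)
    (S : Type u) [CommRing S] [Algebra U S] [IsLocalization P S] [IsNoetherianRing S] [IsLocalRing S]
    [IsDomain (AdicCompletion (maximalIdeal S) S)] (hdim : ringKrullDim S = (2 : ℕ))
    (hiso : IsIsolatedSingularity (AdicCompletion (maximalIdeal S) S)) :
    (∀ m : ℕ, 4 ≤ m → cohomologyAnnihilatorOfDegree (AdicCompletion (maximalIdeal S) S) m =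
        cohomologyAnnihilatorOfDegree (AdicCompletion (maximalIdeal S) S) 4) ∧
      cohomologyAnnihilator (AdicCompletion (maximalIdeal S) S) =
        cohomologyAnnihilatorOfDegree (AdicCompletion (maximalIdeal S) S) 4 := by
  haveI : IsNoetherianRing (AdicCompletion (maximalIdeal S) S) := isNoetherianRing_adicCompletion_maximalIdeal S
  have hdim' : ringKrullDim (AdicCompletion (maximalIdeal S) S) = (2 : ℕ) := by
    rw [ringKrullDim_adicCompletion, hdim]
  exact levelledSatFour_of_completionLike U hU hq P S (AdicCompletion (maximalIdeal S) S)
    AdicCompletion.maximalIdeal_eq_map.symm (dense_adicCompletion S) hdim' hiso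

include hU in
/-- **Levelled `Sat₄` on the completion AT THE VERTEX**: for the vertex `𝔪 ∋ uⁿ, vⁿ` of `U = k[u,v]^{(n;1,q)}`
(`gcd(q,n) = 1`) and any localisation `S` of `U` at `𝔪` whose completion is a domain and an isolated singularity,
`caᵐ(Ŝ) = ca⁴(Ŝ) = ca(Ŝ)` for `m ≥ 4` (`dim S = 2` by `…VertexDimension.ringKrullDim_atVertex`). [OURS · cell decomp-res] -/
theorem levelledSatFour_adicCompletion_atVertex (hq : q.Coprime n) (𝔪 : Ideal U) [𝔪.IsMaximal]
    (hu : (⟨(X 0 : MvPolynomial (Fin 2) k) ^ n, X_pow_mem U hU 0⟩ : U) ∈ 𝔪)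
    (hv : (⟨(X 1 : MvPolynomial (Fin 2) k) ^ n, X_pow_mem U hU 1⟩ : U) ∈ 𝔪)
    (S : Type u) [CommRing S] [Algebra U S] [IsLocalization.AtPrime S 𝔪] [IsNoetherianRing S] [IsLocalRing S]
    [IsDomain (AdicCompletion (maximalIdeal S) S)]
    (hiso : IsIsolatedSingularity (AdicCompletion (maximalIdeal S) S)) :
    (∀ m : ℕ, 4 ≤ m → cohomologyAnnihilatorOfDegree (AdicCompletion (maximalIdeal S) S) m =
        cohomologyAnnihilatorOfDegree (AdicCompletion (maximalIdeal S) S) 4) ∧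
      cohomologyAnnihilator (AdicCompletion (maximalIdeal S) S) =
        cohomologyAnnihilatorOfDegree (AdicCompletion (maximalIdeal S) S) 4 :=
  levelledSatFour_adicCompletion U hU hq 𝔪.primeCompl S (ringKrullDim_atVertex U hU 𝔪 hu hv S) hiso

/-! ## (F4) `Sat₄` at every analytically-toric surface stage -/

include hU in
/-- **(F4) `ca(T) ⊆ ca⁴(T)` AT EVERY ANALYTICALLY-TORIC SURFACE STAGE.**  `T` noetherian local of Krull dimension `2`
whose `𝔪`-adic completion `T̂` is a domain and an isolated singularity; `S` a noetherian local localisation of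
`U = k[u,v]^{(n;1,q)}` (`gcd(q,n) = 1`, `k` any field) at its vertex `𝔪 ∋ uⁿ, vⁿ` with `Ŝ` an isolated singularity;
`e : T̂ ≃+* Ŝ`.  Then `ca(T) ⊆ ca⁴(T)` — the stub's `Sat₄` (not the shifted `Sat₆` of `…VertexDimension`): levelled
`Sat₄` on `Ŝ` (`Ŝ` is a domain along `e`) through the level-exact door
`…CommonCompletion.cohomologyAnnihilator_le_caAt_of_levelled_of_ringEquiv_completion`.
[cite: BahlekehHakimianSalarianTakahashi2015, Thm. 4.5] -/
theorem cohomologyAnnihilator_le_caAt_four_of_ringEquiv_completion_vertex (hq : q.Coprime n) (𝔪 : Ideal U)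
    [𝔪.IsMaximal] (hu : (⟨(X 0 : MvPolynomial (Fin 2) k) ^ n, X_pow_mem U hU 0⟩ : U) ∈ 𝔪)
    (hv : (⟨(X 1 : MvPolynomial (Fin 2) k) ^ n, X_pow_mem U hU 1⟩ : U) ∈ 𝔪)
    (S : Type u) [CommRing S] [Algebra U S] [IsLocalization.AtPrime S 𝔪] [IsNoetherianRing S] [IsLocalRing S]
    {T : Type u} [CommRing T] [IsNoetherianRing T] [IsLocalRing T] (hdT : ringKrullDim T = (2 : ℕ))
    [IsDomain (AdicCompletion (maximalIdeal T) T)]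
    (hisoS : IsIsolatedSingularity (AdicCompletion (maximalIdeal S) S))
    (hisoT : IsIsolatedSingularity (AdicCompletion (maximalIdeal T) T))
    (e : AdicCompletion (maximalIdeal T) T ≃+* AdicCompletion (maximalIdeal S) S) :
    cohomologyAnnihilator T ≤ cohomologyAnnihilatorOfDegree T 4 := by
  haveI : IsDomain (AdicCompletion (maximalIdeal S) S) :=
    MulEquiv.isDomain (AdicCompletion (maximalIdeal T) T) e.symm.toMulEquiv
  obtain ⟨hlev, -⟩ := levelledSatFour_adicCompletion_atVertex U hU hq 𝔪 hu hv S hisoS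
  exact cohomologyAnnihilator_le_caAt_of_levelled_of_ringEquiv_completion hdT hisoT e fun m hm => (hlev m hm).le

include hU in
/-- **(F4, levelled form) `caᵐ(T) = ca(T)` for every `m ≥ 4` at every analytically-toric surface stage** (hypotheses
as in `cohomologyAnnihilator_le_caAt_four_of_ringEquiv_completion_vertex`): `ca⁴(T) ⊆ caᵐ(T) ⊆ ca(T) ⊆ ca⁴(T)`.
[OURS · cell decomp-res] -/
theorem cohomologyAnnihilatorOfDegree_eq_of_ringEquiv_completion_vertex (hq : q.Coprime n) (𝔪 : Ideal U)
    [𝔪.IsMaximal] (hu : (⟨(X 0 : MvPolynomial (Fin 2) k) ^ n, X_pow_mem U hU 0⟩ : U) ∈ 𝔪)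
    (hv : (⟨(X 1 : MvPolynomial (Fin 2) k) ^ n, X_pow_mem U hU 1⟩ : U) ∈ 𝔪)
    (S : Type u) [CommRing S] [Algebra U S] [IsLocalization.AtPrime S 𝔪] [IsNoetherianRing S] [IsLocalRing S]
    {T : Type u} [CommRing T] [IsNoetherianRing T] [IsLocalRing T] (hdT : ringKrullDim T = (2 : ℕ))
    [IsDomain (AdicCompletion (maximalIdeal T) T)]
    (hisoS : IsIsolatedSingularity (AdicCompletion (maximalIdeal S) S))
    (hisoT : IsIsolatedSingularity (AdicCompletion (maximalIdeal T) T))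
    (e : AdicCompletion (maximalIdeal T) T ≃+* AdicCompletion (maximalIdeal S) S) {m : ℕ} (hm : 4 ≤ m) :
    cohomologyAnnihilatorOfDegree T m = cohomologyAnnihilator T := by
  have h4 := cohomologyAnnihilator_le_caAt_four_of_ringEquiv_completion_vertex U hU hq 𝔪 hu hv S hdT hisoS hisoT e
  exact le_antisymm (cohomologyAnnihilatorOfDegree_le m) (h4.trans (cohomologyAnnihilatorOfDegree_mono hm))

end Summit.ResolutionOfSingularities.ResolutionOfSingularities.Theorems.HomologicalConductor.PersistenceCyclicQuotientCompletionSatFour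

end
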